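import Summits.MatrixMultiplication.MatrixMultiplication.Theorems.ThinPackings.Negative.FrameVolumeExcess

/-!
# FrameNoExcess for coordinate frames (crux `ThinPackings`, stmt-MatrixMultiplication-10595)

Line `three-sphere-frame-designs`, stub `coordFrames_volume_le` (lead c2, 2026-08-16).

A *coordinate* frame family in the box `[-b, b]^D ⊂ ℤ^D` is a family of blocks `(A i, B i, C i)` whose three
legs are supported on pairwise disjoint coordinate sets `SA i`, `SB i`, `SC i`.  For such families the
conjecture `FrameNoExcess` (`Σᵢ |Aᵢ||Bᵢ||Cᵢ| ≤ (6b+1)^D`, see `FrameVolumeExcess.lean`) holds in EVERY box: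
we run the tensor-stable certificate `volume_le_pow_of_coordPrice` with the two-valued coordinatewise price
`w 0 = 2b+1`, `w u = 1 (u ≠ 0)`, whose budget over `[-2b, 2b]` is exactly `(2b+1) + 4b = 6b+1`.

The single-block inequality `V³ ≤ q(C−A)·q(B−A)·q(B−C)` for a coordinate block: with `sA, sB, sC` the support
sizes (`sA+sB+sC ≤ D` by disjointness) one has `V ≤ (2b+1)^{sA+sB+sC}` (each leg lives in a sub-box), while a
tile `z − x` (`x ∈ A`, `z ∈ C`) vanishes off `SA ∪ SC`, so its price is `≥ (2b+1)^{D−sA−sC}`; summing,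
`q(C−A)·q(B−A)·q(B−C) ≥ V²·(2b+1)^{3D−2s} ≥ V²·(2b+1)^{s} ≥ V³`.

The price `w` is kept abstract in the lemmas (hypotheses `w 0 = 2b+1`, `w u = 1` for `u ≠ 0`, resp. `1 ≤ w u`)
and instantiated only inside the final theorem.  Elementary and sorry-free.
-/

set_option linter.dupNamespace false  -- `Summit.<S>.<S>.…` is the mandated namespace

namespace Summit.MatrixMultiplication.MatrixMultiplication.Theorems.ThinPackings.Negative

open Finset

section CoordinateFrames

variable {D : ℕ}

/-- Budget of the two-valued price (`w 0 = 2b+1`, `w u = 1` for `u ≠ 0`) over the doubled interval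
`[-2b, 2b]`: `(2b+1) + 4b = 6b+1`. [new, elementary] -/
theorem sum_twoValPrice_box (w : ℕ → ℝ) (b : ℕ) (hw0 : w 0 = 2 * (b : ℝ) + 1)
    (hw' : ∀ u, u ≠ 0 → w u = 1) :
    ∑ u ∈ Icc (-(2 * b : ℤ)) (2 * b), w u.natAbs = 6 * b + 1 := by
  have h0 : (0 : ℤ) ∈ Icc (-(2 * b : ℤ)) (2 * b) := by
    rw [mem_Icc]; constructor <;> omega
  rw [← add_sum_erase _ _ h0, Int.natAbs_zero, hw0]
  have h1 : ∑ u ∈ (Icc (-(2 * b : ℤ)) (2 * b)).erase 0, w u.natAbs =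
      ∑ _u ∈ (Icc (-(2 * b : ℤ)) (2 * b)).erase 0, (1 : ℝ) := by
    refine sum_congr rfl fun u hu => ?_
    exact hw' _ (Int.natAbs_ne_zero.2 (mem_erase.1 hu).1)
  have hcard : ((Icc (-(2 * b : ℤ)) (2 * b)).erase 0).card = 4 * b := by
    rw [card_erase_of_mem h0, Int.card_Icc]; omega
  rw [h1, sum_const, hcard, nsmul_eq_mul, mul_one]
  push_cast; ring

/-- Legs with disjoint coordinate supports are orthogonal. [folklore] -/
theorem dotProduct_eq_zero_of_disjoint_supports {S T : Finset (Fin D)} {x y : Fin D → ℤ}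
    (hST : Disjoint S T) (hx : ∀ t ∉ S, x t = 0) (hy : ∀ t ∉ T, y t = 0) : x ⬝ᵥ y = 0 := by
  unfold dotProduct
  refine sum_eq_zero fun t _ => ?_
  by_cases ht : t ∈ S
  · rw [hy t (Finset.disjoint_left.1 hST ht), mul_zero]
  · rw [hx t ht, zero_mul]

/-- A set of box vectors supported on `S` has at most `(2b+1)^{|S|}` elements. [folklore] -/
theorem card_le_pow_of_support {b : ℕ} (X : Finset (Fin D → ℤ)) (S : Finset (Fin D))
    (hsupp : ∀ v ∈ X, ∀ t ∉ S, v t = 0) (hbox : ∀ v ∈ X, ∀ t, |v t| ≤ (b : ℤ)) :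
    X.card ≤ (2 * b + 1) ^ S.card := by
  classical
  have hsub : X ⊆ Fintype.piFinset fun t : Fin D => if t ∈ S then Icc (-(b : ℤ)) b else {0} := by
    intro v hv
    refine Fintype.mem_piFinset.2 fun t => ?_
    split_ifs with ht
    · exact mem_Icc.2 (abs_le.1 (hbox v hv t))
    · exact mem_singleton.2 (hsupp v hv t ht)
  have hcard : (Fintype.piFinset fun t : Fin D => if t ∈ S then Icc (-(b : ℤ)) b else {0}).card =
      (2 * b + 1) ^ S.card := by
    rw [Fintype.card_piFinset]
    have h : ∀ t ∈ (univ : Finset (Fin D)),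
        (if t ∈ S then Icc (-(b : ℤ)) b else ({0} : Finset ℤ)).card = if t ∈ S then 2 * b + 1 else 1 := by
      intro t _
      split_ifs
      · rw [Int.card_Icc]; omega
      · rfl
    rw [prod_congr rfl h, prod_ite_mem, univ_inter, prod_const]
  exact (card_le_card hsub).trans hcard.le

/-- A vector vanishing off `S` has price at least `(2b+1)^{D − |S|}` for any coordinatewise price `w ≥ 1`
with `w 0 = 2b+1`. [new, elementary] -/
theorem pow_le_coordPrice_of_support (w : ℕ → ℝ) (b : ℕ) (hw0 : w 0 = 2 * (b : ℝ) + 1)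
    (hw1 : ∀ u, 1 ≤ w u) (v : Fin D → ℤ) (S : Finset (Fin D)) (hv : ∀ t ∉ S, v t = 0) :
    (2 * (b : ℝ) + 1) ^ (D - S.card) ≤ coordPrice w v := by
  classical
  have h1 : ∏ t : Fin D, (if t ∈ Sᶜ then (2 * (b : ℝ) + 1) else 1) = (2 * (b : ℝ) + 1) ^ (D - S.card) := by
    rw [Fintype.prod_ite_mem, prod_const, card_compl, Fintype.card_fin]
  rw [← h1]
  unfold coordPrice
  apply prod_le_prod
  · intro t _
    split_ifs
    · positivity
    · exact zero_le_one
  · intro t _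
    split_ifs with ht
    · rw [mem_compl] at ht
      rw [hv t ht, Int.natAbs_zero, hw0]
    · exact hw1 _

/-- Summing the tile price bound over a pair of legs: `|X|·|Z|·(2b+1)^{D−|S|} ≤ Σ_{x,z} q(z − x)` when all
tiles `z − x` vanish off `S`. [new, elementary] -/
theorem card_mul_pow_le_sum_coordPrice (w : ℕ → ℝ) (b : ℕ) (hw0 : w 0 = 2 * (b : ℝ) + 1)
    (hw1 : ∀ u, 1 ≤ w u) (X Z : Finset (Fin D → ℤ)) (S : Finset (Fin D))
    (h : ∀ x ∈ X, ∀ z ∈ Z, ∀ t ∉ S, (z - x) t = 0) :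
    (X.card : ℝ) * ((Z.card : ℝ) * (2 * (b : ℝ) + 1) ^ (D - S.card)) ≤
      ∑ x ∈ X, ∑ z ∈ Z, coordPrice w (z - x) := by
  calc (X.card : ℝ) * ((Z.card : ℝ) * (2 * (b : ℝ) + 1) ^ (D - S.card))
      = ∑ _x ∈ X, ∑ _z ∈ Z, (2 * (b : ℝ) + 1) ^ (D - S.card) := by
        rw [sum_const, sum_const, nsmul_eq_mul, nsmul_eq_mul]
    _ ≤ ∑ x ∈ X, ∑ z ∈ Z, coordPrice w (z - x) :=
        sum_le_sum fun x hx => sum_le_sum fun z hz =>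
          pow_le_coordPrice_of_support w b hw0 hw1 (z - x) S (h x hx z hz)

/-- **The single-block inequality for coordinate blocks.**  If the legs `A, B, C ⊂ [-b, b]^D` are supported on
pairwise disjoint coordinate sets, then `(|A||B||C|)³ ≤ q(C−A)·q(B−A)·q(B−C)` for every coordinatewise price
`w ≥ 1` with `w 0 = 2b+1`. [new, elementary] -/
theorem coordBlock_cube_le (w : ℕ → ℝ) (b : ℕ) (hw0 : w 0 = 2 * (b : ℝ) + 1) (hw1 : ∀ u, 1 ≤ w u)
    (A B C : Finset (Fin D → ℤ)) (SA SB SC : Finset (Fin D))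
    (hdisj : Disjoint SA SB ∧ Disjoint SA SC ∧ Disjoint SB SC)
    (hsupp : (∀ v ∈ A, ∀ t ∉ SA, v t = 0) ∧ (∀ v ∈ B, ∀ t ∉ SB, v t = 0) ∧ (∀ v ∈ C, ∀ t ∉ SC, v t = 0))
    (hbox : (∀ v ∈ A, ∀ t, |v t| ≤ (b : ℤ)) ∧ (∀ v ∈ B, ∀ t, |v t| ≤ (b : ℤ)) ∧
      (∀ v ∈ C, ∀ t, |v t| ≤ (b : ℤ))) :
    ((A.card * B.card * C.card : ℕ) : ℝ) ^ 3 ≤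
      (∑ x ∈ A, ∑ z ∈ C, coordPrice w (z - x)) * (∑ x ∈ A, ∑ y ∈ B, coordPrice w (y - x)) *
        ∑ z ∈ C, ∑ y ∈ B, coordPrice w (y - z) := by
  obtain ⟨hAB, hAC, hBC⟩ := hdisj
  obtain ⟨hsA, hsB, hsC⟩ := hsupp
  obtain ⟨hbA, hbB, hbC⟩ := hbox
  have hX1 : (1 : ℝ) ≤ 2 * (b : ℝ) + 1 := by
    have : (0 : ℝ) ≤ b := Nat.cast_nonneg b
    linarith
  have hX0 : (0 : ℝ) ≤ 2 * (b : ℝ) + 1 := zero_le_one.trans hX1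
  -- (a) the supports fit in `D` coordinates
  have hsD : SA.card + SB.card + SC.card ≤ D := by
    have h3 : (SA ∪ SB ∪ SC).card = SA.card + SB.card + SC.card := by
      rw [card_union_of_disjoint (disjoint_union_left.2 ⟨hAC, hBC⟩), card_union_of_disjoint hAB]
    have h4 := card_le_univ (SA ∪ SB ∪ SC)
    rw [Fintype.card_fin, h3] at h4
    exact h4
  -- (b) the legs live in sub-boxes
  have hcA : (A.card : ℝ) ≤ (2 * (b : ℝ) + 1) ^ SA.card := by
    exact_mod_cast card_le_pow_of_support A SA hsA hbA
  have hcB : (B.card : ℝ) ≤ (2 * (b : ℝ) + 1) ^ SB.card := by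
    exact_mod_cast card_le_pow_of_support B SB hsB hbB
  have hcC : (C.card : ℝ) ≤ (2 * (b : ℝ) + 1) ^ SC.card := by
    exact_mod_cast card_le_pow_of_support C SC hsC hbC
  have hV : ((A.card * B.card * C.card : ℕ) : ℝ) ≤
      (2 * (b : ℝ) + 1) ^ ((D - (SA.card + SC.card)) + (D - (SA.card + SB.card)) + (D - (SB.card + SC.card))) := by
    have h1 : ((A.card * B.card * C.card : ℕ) : ℝ) ≤ (2 * (b : ℝ) + 1) ^ (SA.card + SB.card + SC.card) := by
      push_cast
      rw [pow_add, pow_add]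
      exact mul_le_mul (mul_le_mul hcA hcB (Nat.cast_nonneg _) (pow_nonneg hX0 _)) hcC (Nat.cast_nonneg _)
        (mul_nonneg (pow_nonneg hX0 _) (pow_nonneg hX0 _))
    exact h1.trans (pow_le_pow_right₀ hX1 (by omega))
  -- (c)+(d) the three priced tile sums
  have hT : (A.card : ℝ) * ((C.card : ℝ) * (2 * (b : ℝ) + 1) ^ (D - (SA.card + SC.card))) ≤
      ∑ x ∈ A, ∑ z ∈ C, coordPrice w (z - x) := by
    refine le_trans ?_ (card_mul_pow_le_sum_coordPrice w b hw0 hw1 A C (SA ∪ SC) fun x hx z hz t ht => ?_)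
    · exact mul_le_mul_of_nonneg_left (mul_le_mul_of_nonneg_left
        (pow_le_pow_right₀ hX1 (Nat.sub_le_sub_left (card_union_le SA SC) D)) (Nat.cast_nonneg _))
        (Nat.cast_nonneg _)
    · rw [mem_union, not_or] at ht
      rw [Pi.sub_apply, hsA x hx t ht.1, hsC z hz t ht.2, sub_zero]
  have hE : (A.card : ℝ) * ((B.card : ℝ) * (2 * (b : ℝ) + 1) ^ (D - (SA.card + SB.card))) ≤
      ∑ x ∈ A, ∑ y ∈ B, coordPrice w (y - x) := by
    refine le_trans ?_ (card_mul_pow_le_sum_coordPrice w b hw0 hw1 A B (SA ∪ SB) fun x hx y hy t ht => ?_)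
    · exact mul_le_mul_of_nonneg_left (mul_le_mul_of_nonneg_left
        (pow_le_pow_right₀ hX1 (Nat.sub_le_sub_left (card_union_le SA SB) D)) (Nat.cast_nonneg _))
        (Nat.cast_nonneg _)
    · rw [mem_union, not_or] at ht
      rw [Pi.sub_apply, hsA x hx t ht.1, hsB y hy t ht.2, sub_zero]
  have hF : (C.card : ℝ) * ((B.card : ℝ) * (2 * (b : ℝ) + 1) ^ (D - (SB.card + SC.card))) ≤
      ∑ z ∈ C, ∑ y ∈ B, coordPrice w (y - z) := by
    refine le_trans ?_ (card_mul_pow_le_sum_coordPrice w b hw0 hw1 C B (SB ∪ SC) fun z hz y hy t ht => ?_)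
    · exact mul_le_mul_of_nonneg_left (mul_le_mul_of_nonneg_left
        (pow_le_pow_right₀ hX1 (Nat.sub_le_sub_left (card_union_le SB SC) D)) (Nat.cast_nonneg _))
        (Nat.cast_nonneg _)
    · rw [mem_union, not_or] at ht
      rw [Pi.sub_apply, hsB y hy t ht.1, hsC z hz t ht.2, sub_zero]
  have hTnn : (0 : ℝ) ≤ ∑ x ∈ A, ∑ z ∈ C, coordPrice w (z - x) := le_trans (by positivity) hT
  have hEnn : (0 : ℝ) ≤ ∑ x ∈ A, ∑ y ∈ B, coordPrice w (y - x) := le_trans (by positivity) hE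
  -- (e) assemble
  calc ((A.card * B.card * C.card : ℕ) : ℝ) ^ 3
      = ((A.card * B.card * C.card : ℕ) : ℝ) ^ 2 * ((A.card * B.card * C.card : ℕ) : ℝ) := by ring
    _ ≤ ((A.card * B.card * C.card : ℕ) : ℝ) ^ 2 * (2 * (b : ℝ) + 1) ^
          ((D - (SA.card + SC.card)) + (D - (SA.card + SB.card)) + (D - (SB.card + SC.card))) :=
        mul_le_mul_of_nonneg_left hV (by positivity)
    _ = ((A.card : ℝ) * ((C.card : ℝ) * (2 * (b : ℝ) + 1) ^ (D - (SA.card + SC.card)))) *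
          ((A.card : ℝ) * ((B.card : ℝ) * (2 * (b : ℝ) + 1) ^ (D - (SA.card + SB.card)))) *
          ((C.card : ℝ) * ((B.card : ℝ) * (2 * (b : ℝ) + 1) ^ (D - (SB.card + SC.card)))) := by
        push_cast; ring
    _ ≤ _ := mul_le_mul (mul_le_mul hT hE (by positivity) hTnn) hF (by positivity) (mul_nonneg hTnn hEnn)

/-- **FrameNoExcess for coordinate frames, every box.**  For a family of blocks in `[-b, b]^D` whose three legs
are supported on pairwise disjoint coordinate sets and whose tiles `z − x`, `y − x`, `y − z` satisfy the three
weak packings, the total volume `Σᵢ |Aᵢ||Bᵢ||Cᵢ|` is at most `(6b+1)^D` — the size of the carry-free host.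
Proof: `volume_le_pow_of_coordPrice` with the two-valued price `w 0 = 2b+1`, `w u = 1 (u ≠ 0)` (budget
`6b+1`, `sum_twoValPrice_box`) and the block inequality `coordBlock_cube_le`. [new, elementary] -/
theorem coordFrames_volume_le :
    ∀ (D L b : ℕ) (A B C : Fin L → Finset (Fin D → ℤ)) (SA SB SC : Fin L → Finset (Fin D)), (∀ i, Disjoint (SA i) (SB i) ∧ Disjoint (SA i) (SC i) ∧ Disjoint (SB i) (SC i)) → (∀ i, (∀ v ∈ A i, ∀ t ∉ SA i, v t = 0) ∧ (∀ v ∈ B i, ∀ t ∉ SB i, v t = 0) ∧ (∀ v ∈ C i, ∀ t ∉ SC i, v t = 0)) → (∀ i, (∀ v ∈ A i, ∀ t, |v t| ≤ (b : ℤ)) ∧ (∀ v ∈ B i, ∀ t, |v t| ≤ (b : ℤ)) ∧ (∀ v ∈ C i, ∀ t, |v t| ≤ (b : ℤ))) → (∀ i k, ∀ x ∈ A i, ∀ z ∈ C i, ∀ x' ∈ A k, ∀ z' ∈ C k, z - x = z' - x' → i = k) → (∀ i k, ∀ x ∈ A i, ∀ y ∈ B i, ∀ x' ∈ A k, ∀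 y' ∈ B k, y - x = y' - x' → i = k) → (∀ i k, ∀ y ∈ B i, ∀ z ∈ C i, ∀ y' ∈ B k, ∀ z' ∈ C k, y - z = y' - z' → i = k) → ∑ i, (A i).card * (B i).card * (C i).card ≤ (6 * b + 1) ^ D := by
  intro D L b A B C SA SB SC hdisj hsupp hbox hPD hPE hPF
  -- the two-valued price, kept opaque
  obtain ⟨w, hw0, hw'⟩ : ∃ w : ℕ → ℝ, w 0 = 2 * (b : ℝ) + 1 ∧ ∀ u, u ≠ 0 → w u = 1 :=
    ⟨fun u => if u = 0 then 2 * (b : ℝ) + 1 else 1, if_pos rfl, fun u hu => if_neg hu⟩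
  have hw1 : ∀ u, 1 ≤ w u := by
    intro u
    rcases eq_or_ne u 0 with rfl | hu
    · rw [hw0]
      have : (0 : ℝ) ≤ b := Nat.cast_nonneg b
      linarith
    · rw [hw' u hu]
  have hw : ∀ u, 0 ≤ w u := fun u => zero_le_one.trans (hw1 u)
  -- disjoint supports give the pointwise-orthogonal frame condition
  have hfr : (∀ i, ∀ x ∈ A i, ∀ y ∈ B i, x ⬝ᵥ y = 0) ∧ (∀ i, ∀ x ∈ A i, ∀ z ∈ C i, x ⬝ᵥ z = 0) ∧
      (∀ i, ∀ y ∈ B i, ∀ z ∈ C i, y ⬝ᵥ z = 0) :=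
    ⟨fun i x hx y hy =>
      dotProduct_eq_zero_of_disjoint_supports (hdisj i).1 ((hsupp i).1 x hx) ((hsupp i).2.1 y hy),
     fun i x hx z hz =>
      dotProduct_eq_zero_of_disjoint_supports (hdisj i).2.1 ((hsupp i).1 x hx) ((hsupp i).2.2 z hz),
     fun i y hy z hz =>
      dotProduct_eq_zero_of_disjoint_supports (hdisj i).2.2 ((hsupp i).2.1 y hy) ((hsupp i).2.2 z hz)⟩
  have key := volume_le_pow_of_coordPrice w hw b A B C hbox hfr hPD hPE hPF
    fun i => coordBlock_cube_le w b hw0 hw1 (A i) (B i) (C i) (SA i) (SB i) (SC i) (hdisj i) (hsupp i) (hbox i)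
  rw [sum_twoValPrice_box w b hw0 hw'] at key
  exact_mod_cast key

end CoordinateFrames

end Summit.MatrixMultiplication.MatrixMultiplication.Theorems.ThinPackings.Negative
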